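import Summits.AnomalousDissipation.AnomalousDissipation.Theorems.SawtoothPulseCascadeK2ParallelDatum
import Summits.AnomalousDissipation.AnomalousDissipation.Theorems.SawtoothPulseCascadeK2ClassicalEnergyRung
import Summits.AnomalousDissipation.AnomalousDissipation.Theorems.SawtoothPulseCascadeK2ClassicalWindow
import Mathlib.Analysis.Complex.ExponentialBounds

/-!
# K2″ injection phase, H half-slot type (`hz = true`): parallel heat on the H half, energy method on
# the V half — factor `e^{γ}`, hence the cap `(3e^{σ⋆γ})²` for `γ ≤ 5.77`
(route `AnomalousDissipation/SawtoothPulseCascade`, crux K2″ = stmt-AnomalousDissipation-19696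
`K2LinearisedCascadeGrowth`, registered line `phase-cocycle`, stub A `stub_injectionPhase`; helper)

The registered stub A of the line `phase-cocycle` asks, for every box point `(γ, ρN) ∈ [4,8] × {2,…,7}`,
for a threshold `ν₀ > 0` such that every classical solution `(w, q)` of the Navier–Stokes equations
linearised at the cascade carrier on the injection window `[tInject j₀ hz, tStart (j₀+1)]`, started from a
residual-comb injection `w₀` (`ShearCombDatum (P.N j₀) hz w₀`), obeys
`‖w(t)‖²_{L²} ≤ (3e^{σ⋆γ})² ‖w₀‖²_{L²}` on the whole window.  Its `hz = false` half is the landed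
`K2Classical.k2_injectionPhase_V` (factor `1`, every `ν > 0`, p458821).  This file does the `hz = true`
half as far as the tree's tools reach (numbers, not adjectives):

* `k2_injectionPhase_H_slot`: on the H half-slot `[tStart j₀, tStart j₀ + tHalf j₀]` the response IS a
  horizontal parallel heat profile `H(x₂) e₁` and `‖w(t)‖² ≤ ‖w₀‖²` (restriction of the window solution to
  the slot + `K2Classical.parallel_H_of_datum`);
* `k2_injectionPhase_H`: on the whole injection window `‖w(t)‖² ≤ e^{γ} ‖w₀‖²` for EVERY `ν > 0` and
  `γ ≥ 0` (H half: factor `1`; V half: the tree's classical half-pulse energy bound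
  `K2Classical.vectorL2Sq_le_exp_of_mem_V`, factor `e^{γ}`) — versus `e^{2γ}` of the plain energy rung
  `K2Classical.vectorL2Sq_le_exp_sq_of_mem_phase`;
* `exp_one_sub_two_mul_sawSigmaStar_mul_le`: `e^{(1−2σ⋆)γ} ≤ 9` for `γ ≤ 5.77`
  (`(1−2σ⋆)·5.77 = 2.1946772 < ln 9 = 2.1972…`; `Real.exp_one_lt_d9` and `Real.exp_bound'`), whence
  `exp_le_cap_sq`: `e^{γ} ≤ (3e^{σ⋆γ})²` for `γ ≤ 5.77`;
* `k2_injectionPhase_H_bound`: the stub-A conclusion `‖w(t)‖² ≤ (3e^{σ⋆γ})² ‖w₀‖²` for `hz = true`,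
  every `ν > 0`, provided `γ ≤ 5.77`;
* `injectionPhase_of_le_577`: **stub A verbatim on the sub-box `γ ∈ [4, 5.77]`** (both half-slot types,
  threshold `ν₀ = 1`, in fact every `ν > 0`).

What is NOT here: `γ ∈ (5.77, 8]` for `hz = true`.  There `e^{γ} > 9e^{2σ⋆γ}` (at `γ = 8`: `2981 > 1277`),
so the V half acting on the H-comb `h(x₂) e₁` (streamwise wavenumbers = odd multiples of `N_{j₀}`, i.e.
relative wavenumbers `≥ 1 > 0.7638`, the modally neutral band of the sawtooth, `sawC2zero_natCast_pos`)
needs a genuine non-modal (Orr + corner-wave) estimate for the rounded, viscous, finite-time V pulse —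
the open content of stub A recorded on the line card.
-/

-- `Summit.<Summit>.<Problem>` is the tree's mandated summit-side namespace (CONVENTIONS §2); for this
-- single-conjunct summit the two coincide, so the duplicate is deliberate (lakefile: off for `Summits`).
set_option linter.dupNamespace false

noncomputable section

namespace Summit.AnomalousDissipation.AnomalousDissipation.Theorems.SawtoothPulseCascade.K2Classical

open Set MeasureTheory
open scoped ContDiff
open Literature.Analysis Literature.Analysis.FunctionSpaces Literature.Analysis.FluidPDE
open Literature.Analysis.FluidPDE.SawtoothCascade
open Literature.Analysis.FluidPDE.SawtoothCascade.CascadeParams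

/-! ## Bookkeeping -/

/-- The one-sided time derivative within a non-degenerate sub-interval `[a', b'] ⊆ [a, b]` of a field
jointly smooth on `[a, b]` agrees with the one within `[a, b]` (Mathlib `HasDerivWithinAt.mono`,
`HasDerivWithinAt.derivWithin`, `uniqueDiffOn_Icc`). -/
private theorem timeDerivWithin_Icc_eq_of_subset_H {a b a' b' : ℝ} (hlt : a' < b')
    (hsub : Icc a' b' ⊆ Icc a b) {w : ℝ → UnitAddTorus (Fin 2) → EuclideanSpace ℝ (Fin 2)}
    (hw : Torus.IsSmoothSpaceTimeOn (Icc a b) w) {t : ℝ} (ht : t ∈ Icc a' b')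
    (x : UnitAddTorus (Fin 2)) :
    Torus.timeDerivWithin (Icc a' b') w t x = Torus.timeDerivWithin (Icc a b) w t x :=
  ((hw.hasDerivWithinAt_slice (hsub ht) x).mono hsub).derivWithin (uniqueDiffOn_Icc hlt t ht)

/-- `0 ≤ ‖v‖²_{L²}`. -/
private theorem vectorL2Sq_nonneg_H (v : UnitAddTorus (Fin 2) → EuclideanSpace ℝ (Fin 2)) :
    0 ≤ Torus.vectorL2Sq v := by
  unfold Torus.vectorL2Sq
  exact integral_nonneg fun _ => by positivity

/-- The H injection time of phase `j₀` is the start of the phase: `tInject j₀ true = tStart j₀`. -/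
theorem tInject_true (j₀ : ℕ) : CascadeParams.tInject j₀ true = tStart j₀ := by
  simp only [CascadeParams.tInject, ↓reduceIte]

/-- The H half-slot of phase `j₀` lies in the H injection window `[tInject j₀ true, tStart (j₀+1)]`. -/
theorem Icc_H_subset_window (j₀ : ℕ) :
    Icc (tStart j₀) (tStart j₀ + tHalf j₀) ⊆ Icc (CascadeParams.tInject j₀ true) (tStart (j₀ + 1)) := by
  intro s hs
  rw [tInject_true, tStart_succ]
  exact ⟨hs.1, by linarith [hs.2, tHalf_pos j₀]⟩

/-- The V half-slot of phase `j₀` lies in the H injection window `[tInject j₀ true, tStart (j₀+1)]`. -/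
theorem Icc_V_subset_window (j₀ : ℕ) :
    Icc (tStart j₀ + tHalf j₀) (tStart (j₀ + 1)) ⊆ Icc (CascadeParams.tInject j₀ true) (tStart (j₀ + 1)) := by
  intro s hs
  rw [tInject_true]
  exact ⟨by linarith [hs.1, tHalf_pos j₀], hs.2⟩

/-! ## The H half of the H injection phase: parallel heat, factor `1` -/

/-- **H injection, H half-slot.** For `δ₀ > 0`, `d > 0`, `ν > 0`, a horizontal residual-comb injection
`w₀` at `tInject j₀ true = tStart j₀` and a classical linearised response `(w, q)` on the injection window
`[tInject j₀ true, tStart (j₀+1)]` with `w (tInject j₀ true) = w₀`: at every time `t` of the H half-slot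
`[tStart j₀, tStart j₀ + tHalf j₀]` the response is a horizontal parallel profile `H(x₂) e₁` (`H` smooth,
`1`-periodic) and `‖w(t)‖²_{L²} ≤ ‖w₀‖²_{L²}` (restriction to the slot + `parallel_H_of_datum`). -/
theorem k2_injectionPhase_H_slot (P : CascadeParams) (hδ₀ : 0 < P.δ₀) (hd : 0 < P.d) {ν : ℝ}
    (hν : 0 < ν) (j₀ : ℕ) (w₀ : UnitAddTorus (Fin 2) → EuclideanSpace ℝ (Fin 2))
    (w : ℝ → UnitAddTorus (Fin 2) → EuclideanSpace ℝ (Fin 2)) (q : ℝ → UnitAddTorus (Fin 2) → ℝ)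
    (hdat : ShearCombDatum (P.N j₀) true w₀)
    (hw : Torus.IsSmoothSpaceTimeOn (Icc (CascadeParams.tInject j₀ true) (tStart (j₀ + 1))) w)
    (hq : Torus.IsSmoothSpaceTimeOn (Icc (CascadeParams.tInject j₀ true) (tStart (j₀ + 1))) q)
    (hdiv : ∀ t ∈ Icc (CascadeParams.tInject j₀ true) (tStart (j₀ + 1)), Torus.IsDivFree (w t))
    (hlin : ∀ t ∈ Icc (CascadeParams.tInject j₀ true) (tStart (j₀ + 1)), ∀ x,
      Torus.timeDerivWithin (Icc (CascadeParams.tInject j₀ true) (tStart (j₀ + 1))) w t x +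
        Torus.convect (P.field t) (w t) x + Torus.convect (w t) (P.field t) x =
          ν • Torus.laplacian (w t) x - Torus.gradient (q t) x)
    (h0 : w (CascadeParams.tInject j₀ true) = w₀)
    {t : ℝ} (ht : t ∈ Icc (tStart j₀) (tStart j₀ + tHalf j₀)) :
    (∃ H : ℝ → ℝ, ContDiff ℝ ∞ H ∧ Function.Periodic H 1 ∧
        w t = fun y => H (Torus.repr y 1) • EuclideanSpace.single (0 : Fin 2) (1 : ℝ)) ∧
      Torus.vectorL2Sq (w t) ≤ Torus.vectorL2Sq w₀ := by
  have hsub := Icc_H_subset_window j₀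
  have hlt : tStart j₀ < tStart j₀ + tHalf j₀ := by linarith [tHalf_pos j₀]
  have hlin' : ∀ s ∈ Icc (tStart j₀) (tStart j₀ + tHalf j₀), ∀ x,
      Torus.timeDerivWithin (Icc (tStart j₀) (tStart j₀ + tHalf j₀)) w s x +
        Torus.convect (P.field s) (w s) x + Torus.convect (w s) (P.field s) x =
          ν • Torus.laplacian (w s) x - Torus.gradient (q s) x := by
    intro s hs x
    rw [timeDerivWithin_Icc_eq_of_subset_H hlt hsub hw hs x]
    exact hlin s (hsub hs) x
  obtain ⟨g, hg, hgper, hw₀⟩ := shearCombDatum_true_eq hdat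
  have h0' : w (tStart j₀) = fun y => g (Torus.repr y 1) • EuclideanSpace.single (0 : Fin 2) (1 : ℝ) := by
    rw [← tInject_true j₀, h0, hw₀]
  have h := parallel_H_of_datum P hδ₀ hd hν hg hgper (hw.mono hsub) (hq.mono hsub)
    (fun s hs => hdiv s (hsub hs)) hlin' h0' ht
  rw [← tInject_true j₀, h0] at h
  exact h

/-! ## The whole H injection phase: factor `e^{γ}` (every `ν > 0`) -/

/-- **H injection, whole injection phase, energy-method constant.** For `γ ≥ 0`, `δ₀ > 0`, `d > 0`,
EVERY `ν > 0`, every phase `j₀`, every horizontal residual-comb injection `w₀` at `tStart j₀` and every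
classical linearised response `(w, q)` on `[tInject j₀ true, tStart (j₀+1)]` with `w (tInject j₀ true) = w₀`:
`‖w(t)‖²_{L²} ≤ e^{γ} ‖w₀‖²_{L²}` on the whole window (H half: parallel heat, factor `1`; V half: the
classical half-pulse energy bound, factor `e^{γ}`).  Half the exponent of the plain energy rung. -/
theorem k2_injectionPhase_H (P : CascadeParams) (hγ : 0 ≤ P.γ) (hδ₀ : 0 < P.δ₀) (hd : 0 < P.d)
    {ν : ℝ} (hν : 0 < ν) (j₀ : ℕ) (w₀ : UnitAddTorus (Fin 2) → EuclideanSpace ℝ (Fin 2))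
    (w : ℝ → UnitAddTorus (Fin 2) → EuclideanSpace ℝ (Fin 2)) (q : ℝ → UnitAddTorus (Fin 2) → ℝ)
    (hdat : ShearCombDatum (P.N j₀) true w₀)
    (hw : Torus.IsSmoothSpaceTimeOn (Icc (CascadeParams.tInject j₀ true) (tStart (j₀ + 1))) w)
    (hq : Torus.IsSmoothSpaceTimeOn (Icc (CascadeParams.tInject j₀ true) (tStart (j₀ + 1))) q)
    (hdiv : ∀ t ∈ Icc (CascadeParams.tInject j₀ true) (tStart (j₀ + 1)), Torus.IsDivFree (w t))
    (hlin : ∀ t ∈ Icc (CascadeParams.tInject j₀ true) (tStart (j₀ + 1)), ∀ x,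
      Torus.timeDerivWithin (Icc (CascadeParams.tInject j₀ true) (tStart (j₀ + 1))) w t x +
        Torus.convect (P.field t) (w t) x + Torus.convect (w t) (P.field t) x =
          ν • Torus.laplacian (w t) x - Torus.gradient (q t) x)
    (h0 : w (CascadeParams.tInject j₀ true) = w₀) :
    ∀ t ∈ Icc (CascadeParams.tInject j₀ true) (tStart (j₀ + 1)),
      Torus.vectorL2Sq (w t) ≤ Real.exp P.γ * Torus.vectorL2Sq w₀ := by
  intro t ht
  have hslot : ∀ s ∈ Icc (tStart j₀) (tStart j₀ + tHalf j₀), Torus.vectorL2Sq (w s) ≤ Torus.vectorL2Sq w₀ :=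
    fun s hs => (k2_injectionPhase_H_slot P hδ₀ hd hν j₀ w₀ w q hdat hw hq hdiv hlin h0 hs).2
  have h1 : 1 ≤ Real.exp P.γ := Real.one_le_exp hγ
  have hE0 := vectorL2Sq_nonneg_H w₀
  have ht' : tStart j₀ ≤ t := by rw [← tInject_true j₀]; exact ht.1
  rcases le_total t (tStart j₀ + tHalf j₀) with h | h
  · calc Torus.vectorL2Sq (w t) ≤ Torus.vectorL2Sq w₀ := hslot t ⟨ht', h⟩
      _ ≤ Real.exp P.γ * Torus.vectorL2Sq w₀ := le_mul_of_one_le_left hE0 h1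
  · have hmid : Torus.vectorL2Sq (w (tStart j₀ + tHalf j₀)) ≤ Torus.vectorL2Sq w₀ :=
      hslot _ ⟨by linarith [tHalf_pos j₀], le_rfl⟩
    calc Torus.vectorL2Sq (w t) ≤ Real.exp P.γ * Torus.vectorL2Sq (w (tStart j₀ + tHalf j₀)) :=
          vectorL2Sq_le_exp_of_mem_V P hγ hδ₀ hd hν.le hw hq hdiv hlin (Icc_V_subset_window j₀) ⟨h, ht.2⟩
      _ ≤ Real.exp P.γ * Torus.vectorL2Sq w₀ := mul_le_mul_of_nonneg_left hmid (Real.exp_pos _).le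

/-! ## The cap swallows the energy factor of ONE half pulse iff `γ ≤ ln 9 / (1 − 2σ⋆) = 5.7767…` -/

/-- `e^{(1 − 2σ⋆)γ} ≤ 9` for `γ ≤ 5.77` (`σ⋆ = 0.30982`, `(1 − 2σ⋆)·5.77 = 2.1946772`,
`e^{2.1946772} = e·e·e^{0.1946772} ≤ 2.7182818286² · 1.21493… = 8.9773 ≤ 9`; Mathlib's
`Real.exp_one_lt_d9` and the Taylor remainder bound `Real.exp_bound'` with four terms). -/
theorem exp_one_sub_two_mul_sawSigmaStar_mul_le {γ : ℝ} (hγ : γ ≤ 5.77) :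
    Real.exp ((1 - 2 * sawSigmaStar) * γ) ≤ 9 := by
  have hx : (1 - 2 * sawSigmaStar) * γ ≤ 1 + 1 + 0.1946772 := by
    simp only [sawSigmaStar]
    linarith
  have h1 : Real.exp 1 < 2.7182818286 := Real.exp_one_lt_d9
  have h2 : Real.exp (0.1946772 : ℝ) ≤ 1.21493131 := by
    have h := Real.exp_bound' (x := (0.1946772 : ℝ)) (by norm_num) (by norm_num) (n := 4) (by norm_num)
    have hs : (∑ m ∈ Finset.range 4, (0.1946772 : ℝ) ^ m / m.factorial) +
        (0.1946772 : ℝ) ^ 4 * (4 + 1) / (Nat.factorial 4 * 4) ≤ 1.21493131 := by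
      simp only [Finset.sum_range_succ, Finset.sum_range_zero, Nat.factorial]
      norm_num
    exact h.trans (by exact_mod_cast hs)
  have h11 : Real.exp 1 * Real.exp 1 ≤ 2.7182818286 * 2.7182818286 := by
    nlinarith [Real.exp_pos (1 : ℝ)]
  calc Real.exp ((1 - 2 * sawSigmaStar) * γ) ≤ Real.exp (1 + 1 + 0.1946772) := Real.exp_le_exp.2 hx
    _ = Real.exp 1 * Real.exp 1 * Real.exp 0.1946772 := by rw [Real.exp_add, Real.exp_add]
    _ ≤ 2.7182818286 * 2.7182818286 * 1.21493131 :=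
        mul_le_mul h11 h2 (Real.exp_pos _).le (by norm_num)
    _ ≤ 9 := by norm_num

/-- `e^{γ} ≤ (3e^{σ⋆γ})²` for `γ ≤ 5.77`: the K2″ cap of ONE phase swallows the energy-method factor of
ONE half pulse (`e^{γ} = e^{(1−2σ⋆)γ}·(e^{σ⋆γ})² ≤ 9 (e^{σ⋆γ})²`). -/
theorem exp_le_cap_sq {γ : ℝ} (hγ : γ ≤ 5.77) :
    Real.exp γ ≤ (3 * Real.exp (sawSigmaStar * γ)) ^ 2 := by
  have h9 := exp_one_sub_two_mul_sawSigmaStar_mul_le hγ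
  have hsplit : Real.exp γ = Real.exp ((1 - 2 * sawSigmaStar) * γ) * Real.exp (sawSigmaStar * γ) ^ 2 := by
    rw [sq, ← Real.exp_add, ← Real.exp_add]
    ring_nf
  rw [hsplit, mul_pow]
  exact mul_le_mul_of_nonneg_right (by linarith) (sq_nonneg _)

/-! ## Stub A, `hz = true`, for `γ ≤ 5.77` -/

/-- **H injection phase under the K2″ cap, `γ ≤ 5.77`.** For `0 ≤ γ ≤ 5.77`, `δ₀ > 0`, `d > 0`, EVERY
`ν > 0`: every classical linearised response to a horizontal residual-comb injection at `tStart j₀`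
satisfies `‖w(t)‖²_{L²} ≤ (3e^{σ⋆γ})² ‖w₀‖²_{L²}` on the whole injection window — the `hz = true`
conclusion of the registered stub `stub_injectionPhase`, on the sub-box `γ ≤ 5.77`. -/
theorem k2_injectionPhase_H_bound (P : CascadeParams) (hγ : 0 ≤ P.γ) (hγ' : P.γ ≤ 5.77)
    (hδ₀ : 0 < P.δ₀) (hd : 0 < P.d) {ν : ℝ} (hν : 0 < ν) (j₀ : ℕ)
    (w₀ : UnitAddTorus (Fin 2) → EuclideanSpace ℝ (Fin 2))
    (w : ℝ → UnitAddTorus (Fin 2) → EuclideanSpace ℝ (Fin 2)) (q : ℝ → UnitAddTorus (Fin 2) → ℝ)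
    (hdat : ShearCombDatum (P.N j₀) true w₀)
    (hw : Torus.IsSmoothSpaceTimeOn (Icc (CascadeParams.tInject j₀ true) (tStart (j₀ + 1))) w)
    (hq : Torus.IsSmoothSpaceTimeOn (Icc (CascadeParams.tInject j₀ true) (tStart (j₀ + 1))) q)
    (hdiv : ∀ t ∈ Icc (CascadeParams.tInject j₀ true) (tStart (j₀ + 1)), Torus.IsDivFree (w t))
    (hlin : ∀ t ∈ Icc (CascadeParams.tInject j₀ true) (tStart (j₀ + 1)), ∀ x,
      Torus.timeDerivWithin (Icc (CascadeParams.tInject j₀ true) (tStart (j₀ + 1))) w t x +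
        Torus.convect (P.field t) (w t) x + Torus.convect (w t) (P.field t) x =
          ν • Torus.laplacian (w t) x - Torus.gradient (q t) x)
    (h0 : w (CascadeParams.tInject j₀ true) = w₀) :
    ∀ t ∈ Icc (CascadeParams.tInject j₀ true) (tStart (j₀ + 1)),
      Torus.vectorL2Sq (w t) ≤ (3 * Real.exp (sawSigmaStar * P.γ)) ^ 2 * Torus.vectorL2Sq w₀ :=
  fun t ht => (k2_injectionPhase_H P hγ hδ₀ hd hν j₀ w₀ w q hdat hw hq hdiv hlin h0 t ht).trans
    (mul_le_mul_of_nonneg_right (exp_le_cap_sq hγ') (vectorL2Sq_nonneg_H w₀))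

/-! ## Stub A verbatim on the sub-box `γ ∈ [4, 5.77]` (both half-slot types) -/

/-- **Stub A of the line `phase-cocycle` on the sub-box `γ ∈ [4, 5.77]`, `ρN ∈ {2,…,7}`** — the
registered signature of `stub_injectionPhase` with `Icc 4 5.77` in place of `Icc 4 8`: threshold `ν₀ = 1`
(every `ν > 0` works), both half-slot types (`hz = false`: `k2_injectionPhase_V`, factor `1`;
`hz = true`: `k2_injectionPhase_H_bound`).  The remaining `γ ∈ (5.77, 8]`, `hz = true`, is the stub's
open non-modal content. -/
theorem injectionPhase_of_le_577 :
    ∀ γ ∈ Icc (4 : ℝ) 5.77, ∀ ρN ∈ Finset.Icc 2 7, ∃ ν₀ : ℝ, 0 < ν₀ ∧ ∀ ν ∈ Ioc 0 ν₀, ∀ (j₀ : ℕ) (hz : Bool)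
      (w₀ : UnitAddTorus (Fin 2) → EuclideanSpace ℝ (Fin 2))
      (w : ℝ → UnitAddTorus (Fin 2) → EuclideanSpace ℝ (Fin 2)) (q : ℝ → UnitAddTorus (Fin 2) → ℝ),
      ShearCombDatum ((⟨γ, 1 / 4, 2, 1, ρN⟩ : CascadeParams).N j₀) hz w₀ →
      Torus.IsSmoothSpaceTimeOn (Icc (CascadeParams.tInject j₀ hz) (CascadeParams.tStart (j₀ + 1))) w →
      Torus.IsSmoothSpaceTimeOn (Icc (CascadeParams.tInject j₀ hz) (CascadeParams.tStart (j₀ + 1))) q →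
      (∀ t ∈ Icc (CascadeParams.tInject j₀ hz) (CascadeParams.tStart (j₀ + 1)), Torus.IsDivFree (w t)) →
      (∀ t ∈ Icc (CascadeParams.tInject j₀ hz) (CascadeParams.tStart (j₀ + 1)), ∀ x,
        Torus.timeDerivWithin (Icc (CascadeParams.tInject j₀ hz) (CascadeParams.tStart (j₀ + 1))) w t x +
          Torus.convect ((⟨γ, 1 / 4, 2, 1, ρN⟩ : CascadeParams).field t) (w t) x +
          Torus.convect (w t) ((⟨γ, 1 / 4, 2, 1, ρN⟩ : CascadeParams).field t) x =
          ν • Torus.laplacian (w t) x - Torus.gradient (q t) x) →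
      w (CascadeParams.tInject j₀ hz) = w₀ →
      ∀ t ∈ Icc (CascadeParams.tInject j₀ hz) (CascadeParams.tStart (j₀ + 1)),
        Torus.vectorL2Sq (w t) ≤ (3 * Real.exp (sawSigmaStar * γ)) ^ 2 * Torus.vectorL2Sq w₀ := by
  intro γ hγ ρN _
  refine ⟨1, one_pos, fun ν hν j₀ hz w₀ w q hdat hw hq hdiv hlin h0 t ht => ?_⟩
  have hγ0 : (0 : ℝ) ≤ γ := by linarith [hγ.1]
  cases hz with
  | true =>
    exact k2_injectionPhase_H_bound ⟨γ, 1 / 4, 2, 1, ρN⟩ hγ0 hγ.2 (by norm_num) (by norm_num) hν.1 j₀ w₀ w q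
      hdat hw hq hdiv hlin h0 t ht
  | false =>
    have hmax : max (CascadeParams.tInject j₀ false) (tStart j₀) = CascadeParams.tInject j₀ false :=
      max_eq_left (tInject_mem_Icc j₀ false).1
    have h1 := k2_injectionPhase_V ⟨γ, 1 / 4, 2, 1, ρN⟩ (by norm_num) (by norm_num) hν.1 j₀ w₀ w q
      hdat hw hq hdiv hlin h0 t (by rw [hmax]; exact ht)
    have hK : 1 ≤ (3 * Real.exp (sawSigmaStar * γ)) ^ 2 := by
      have h0' : (0 : ℝ) ≤ sawSigmaStar * γ := mul_nonneg (by norm_num [sawSigmaStar]) hγ0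
      have : 1 ≤ 3 * Real.exp (sawSigmaStar * γ) := by linarith [Real.one_le_exp h0']
      exact one_le_pow₀ this
    exact h1.trans (le_mul_of_one_le_left (vectorL2Sq_nonneg_H w₀) hK)

end Summit.AnomalousDissipation.AnomalousDissipation.Theorems.SawtoothPulseCascade.K2Classical

end
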